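import Summits.BirchSwinnertonDyer.BirchSwinnertonDyer.Theorems.PrintCf2SplitBadTwoDyadicTorsionStubEll
import HarnessLib

/-!
# Crux `PrintCf2.SplitBadTwoRankOneOfFacts` (stmt-BirchSwinnertonDyer-20368), road α v10.3 — S3c (R-BV) factor (F1), LOCAL piece (L2):
# THE 2-ADIC DEPTH OF THE ℚ-GENERATOR IN `W(ℚ₂)` IS `ℓ + 2 − t([d]₂)` (`= ℓ`, resp. `ℓ − 1` for `d ≡ 3 (mod 8)`)

Cell `bsd-print-cf2`, width seat `bsd-line-cf2-p1-w6` g3 (prover-bsd-line-cf2-p1-w6-g3-0). `--supports stmt-BirchSwinnertonDyer-20368`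
(helper, Theses-free). HONEST FRAMING: nothing here closes the crux or a registered stub; BSD is not proved by any of this; no summit
statement is proved by this seat. No definition, no named fact, no `sorry`.

WHAT. The displayed factor (F1) of (R-BV) (LEAD cut 13, `restrictedControl_two_of_ptFacts_factor_values … (hF1) …`) reads
`v₂ #(Q_M ⊓ ker loc_{v̄}) = ℓ + e₁([d]₂)` with `ℓ` DEFINED by `‖log_Ŵ(z(c₀P₂))/c₀‖ = 2^{−ℓ}` (`P₂ = toPadicPoint 2 P`, `P` the
ℚ-generator). p672763/p673604/p674334 reduced its GLOBAL half to the line `ℤ·e_* res_⊤ κ_N(P_K)`; the LOCAL half is the 2-adic DEPTH of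
`P₂` in `W(ℚ₂)` modulo torsion. THIS FILE computes that depth from the tree's `ℤ₂`-linear logarithm `log = Additive.LocalLog.padicLog (W⊗ℚ₂)`
(kernel = torsion, `padicLog_eq_zero_iff`; image `2^{t−2}ℤ₂ = 2^{[d ≡ 3 (8)]}ℤ₂` on every globally minimal model of the class, -w4 g6
`range_padicLog_two_of_smul_eq_quadraticTwist`; `log(P₂) = log_Ŵ(z(c₀P₂))/c₀`, -w4 g6 `padicLogPoint_nsmul_div_eq_padicLog`):
* `mem_span_two_zpow_iff` — `x ∈ 2^s ℤ₂ ⟺ ‖x‖ ≤ 2^{−s}`;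
* **`exists_pow_smul_add_torsion_iff_of_frame`** — for every `N`: `P₂ ∈ 2^N W(ℚ₂) + W(ℚ₂)_tors ⟺ N + [d % 8 = 3] ≤ ℓ`;
* `exists_pow_smul_add_torsion_iff_of_frame'` — the same with the depth written `ℓ.toNat − [d % 8 = 3]` (`ℓ ≥ [d % 8 = 3] ≥ 0` by -w4 g6
  `le_ell_of_smul_eq_quadraticTwist`): `P₂ ∈ 2^N W(ℚ₂) + tors ⟺ N ≤ ℓ.toNat − [d % 8 = 3]`.
So the depth is `ℓ − [d % 8 = 3] = ℓ + 2 − t([d]₂)`, i.e. **`e₁([d]₂) = 2 − t([d]₂)`** once (L1) «`#(Q_M ⊓ ker loc_{v̄}) = 2^{depth}`» is in.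
presearch: Silverman AEC IV.6.4 / VII.6.3, Kim 2022 §3.2.3 / Lemma 3.10 (log image at an additive prime), -w4 g6 DYADIC-TABLE memo §3
(`ℓ = (t − 2) + ord₂ i_P`) — held / in the tree; no fact filed. beyond-print theorem: no.

References: [SilvermanAEC2009] IV.6.4, VII.6.3; [Kim2022StructureSelmer] §3.2.3, Lemma 3.10; [Serre1973] II §3.3.
-/

noncomputable section

open scoped Classical

set_option linter.dupNamespace false
set_option autoImplicit false

namespace Summit.BirchSwinnertonDyer.BirchSwinnertonDyer.Theorems.PrintCf2.DyadicTorsion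

open WeierstrassCurve Literature.NumberTheory.EllipticCurves
open Summit.BirchSwinnertonDyer.Rank1Residual.Additive.LocalLog

/-- Membership in `2^s ℤ₂ ⊆ ℚ₂` is a norm condition: `x ∈ ℤ₂ · 2^s ⟺ ‖x‖ ≤ 2^{−s}`. [cite: Serre1973, Ch. II §1.1] -/
theorem mem_span_two_zpow_iff (s : ℤ) (x : ℚ_[2]) :
    x ∈ (Submodule.span ℤ_[2] {(2 : ℚ_[2]) ^ s}).toAddSubgroup ↔ ‖x‖ ≤ (2 : ℝ) ^ (-s) := by
  have h2 : ‖(2 : ℚ_[2]) ^ s‖ = (2 : ℝ) ^ (-s) := by exact_mod_cast Padic.norm_p_zpow (p := 2) s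
  have h2ne : (2 : ℚ_[2]) ^ s ≠ 0 := zpow_ne_zero s two_ne_zero
  rw [Submodule.mem_toAddSubgroup, Submodule.mem_span_singleton]
  constructor
  · rintro ⟨a, rfl⟩
    rw [Algebra.smul_def, norm_mul, h2, show (algebraMap ℤ_[2] ℚ_[2]) a = (a : ℚ_[2]) from rfl, ← PadicInt.norm_def]
    have ha : ‖a‖ ≤ 1 := PadicInt.norm_le_one a
    have h0 : 0 ≤ (2 : ℝ) ^ (-s) := zpow_nonneg (by norm_num) _
    nlinarith
  · intro hx
    have hle : ‖x / (2 : ℚ_[2]) ^ s‖ ≤ 1 := by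
      rw [norm_div, h2, div_le_one (zpow_pos (by norm_num) _)]
      exact hx
    refine ⟨⟨x / (2 : ℚ_[2]) ^ s, hle⟩, ?_⟩
    rw [Algebra.smul_def]
    change x / (2 : ℚ_[2]) ^ s * (2 : ℚ_[2]) ^ s = x
    rw [div_mul_cancel₀ x h2ne]

/-- **THE DEPTH OF THE GENERATOR IN `W(ℚ₂)` (factor (F1), local piece).** On the S3c frame — `d` squarefree, `d ≢ 1 (mod 4)`,
`W` a globally minimal model with `C • W = E^{(d)}`, `P ∈ W(ℚ)`, `c₀ ≠ 0` with `[c₀]P₂ ∈ E₁(ℚ₂)` and `‖log_Ŵ(z(c₀P₂))/c₀‖ = 2^{−ℓ}` —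
for every `N`: **`P₂ ∈ 2^N · W(ℚ₂) + W(ℚ₂)_tors ⟺ N + [d ≡ 3 (mod 8)] ≤ ℓ`.** Proof: `log = padicLog (W⊗ℚ₂)` is additive with
kernel the torsion and image `2^{[d ≡ 3 (8)]}ℤ₂`, and `‖log P₂‖ = 2^{−ℓ}`; so `P₂ ≡ 2^N y (mod tors) ⟺ log P₂ ∈ 2^N · image`.
[cite: SilvermanAEC2009, IV.6.4 and VII.6.3] [cite: Kim2022StructureSelmer, Lemma 3.10] -/
theorem exists_pow_smul_add_torsion_iff_of_frame {d : ℤ} (hsq : Squarefree d) (hd4 : d % 4 ≠ 1)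
    (W : WeierstrassCurve ℚ) [W.IsElliptic] [W.IsGloballyMinimal] {C : VariableChange ℚ}
    (hC : C • W = cm7.quadraticTwist (d : ℚ)) {P : W.toAffine.Point} {c₀ : ℕ} {ℓ : ℤ} (hc₀ : c₀ ≠ 0)
    (hker : (W.baseChange ℚ_[2]).IsInReductionKernel (c₀ • W.toPadicPoint 2 P))
    (hℓ : ‖(W.baseChange ℚ_[2]).padicLogPoint (c₀ • W.toPadicPoint 2 P) / (c₀ : ℚ_[2])‖ = (2 : ℝ) ^ (-ℓ)) (N : ℕ) :
    (∃ y T : (W.baseChange ℚ_[2]).toAffine.Point, IsOfFinAddOrder T ∧ 2 ^ N • y + T = W.toPadicPoint 2 P) ↔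
      (N : ℤ) + (if d % 8 = 3 then (1 : ℤ) else 0) ≤ ℓ := by
  set X := W.baseChange ℚ_[2] with hX
  set e : ℤ := if d % 8 = 3 then 1 else 0 with he
  set P₂ := W.toPadicPoint 2 P with hP₂
  have hnorm : ‖padicLog X P₂‖ = (2 : ℝ) ^ (-ℓ) := by
    rw [← padicLogPoint_nsmul_div_eq_padicLog X P₂ hc₀ hker]; exact hℓ
  have hrange := range_padicLog_two_of_smul_eq_quadraticTwist hsq hd4 W hC
  have h2N : ‖(2 : ℚ_[2]) ^ N‖ = (2 : ℝ) ^ (-(N : ℤ)) := by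
    rw [← zpow_natCast]; exact_mod_cast Padic.norm_p_zpow (p := 2) (N : ℤ)
  have h2N0 : (2 : ℚ_[2]) ^ N ≠ 0 := pow_ne_zero _ two_ne_zero
  have hcast : (((2 ^ N : ℕ) : ℚ_[2])) = (2 : ℚ_[2]) ^ N := by push_cast; rfl
  constructor
  · rintro ⟨y, T, hT, hyT⟩
    have hLy : padicLog X y ∈ (padicLog X).range := ⟨y, rfl⟩
    rw [hrange, mem_span_two_zpow_iff] at hLy
    have hLT : padicLog X T = 0 := (padicLog_eq_zero_iff X T).mpr hT
    have hLP : padicLog X P₂ = (2 : ℚ_[2]) ^ N * padicLog X y := by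
      rw [← hyT, map_add, hLT, add_zero, map_nsmul, nsmul_eq_mul, hcast]
    have hle : (2 : ℝ) ^ (-ℓ) ≤ (2 : ℝ) ^ (-(N : ℤ)) * (2 : ℝ) ^ (-e) := by
      rw [← hnorm, hLP, norm_mul, h2N]
      exact mul_le_mul_of_nonneg_left hLy (zpow_nonneg (by norm_num) _)
    rw [← zpow_add₀ (two_ne_zero' ℝ)] at hle
    have := (zpow_le_zpow_iff_right₀ (by norm_num : (1 : ℝ) < 2)).mp hle
    omega
  · intro hle
    have hxn : ‖padicLog X P₂ / (2 : ℚ_[2]) ^ N‖ ≤ (2 : ℝ) ^ (-e) := by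
      rw [norm_div, hnorm, h2N, ← zpow_sub₀ (two_ne_zero' ℝ)]
      exact zpow_le_zpow_right₀ (by norm_num : (1 : ℝ) ≤ 2) (by omega)
    have hxmem : padicLog X P₂ / (2 : ℚ_[2]) ^ N ∈ (padicLog X).range := by
      rw [hrange, mem_span_two_zpow_iff]; exact hxn
    obtain ⟨y, hy⟩ := hxmem
    refine ⟨y, P₂ - 2 ^ N • y, ?_, by abel⟩
    rw [← padicLog_eq_zero_iff X, map_sub, map_nsmul, hy, nsmul_eq_mul, hcast, mul_div_cancel₀ _ h2N0, sub_self]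

/-- **The depth as a number.** Same frame; with `D := ℓ.toNat − [d ≡ 3 (mod 8)]` (recall `ℓ ≥ [d ≡ 3 (8)] ≥ 0`,
`le_ell_of_smul_eq_quadraticTwist`): `P₂ ∈ 2^N · W(ℚ₂) + W(ℚ₂)_tors ⟺ N ≤ D`. So `D = ℓ + 2 − t([d]₂)` is the exact
2-power depth of `P₂` modulo torsion. [cite: SilvermanAEC2009, IV.6.4 and VII.6.3] [cite: Kim2022StructureSelmer, Lemma 3.10] -/
theorem exists_pow_smul_add_torsion_iff_of_frame' {d : ℤ} (hd : d ≠ 0) (hsq : Squarefree d) (hd4 : d % 4 ≠ 1)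
    (W : WeierstrassCurve ℚ) [W.IsElliptic] [W.IsGloballyMinimal] {C : VariableChange ℚ}
    (hC : C • W = cm7.quadraticTwist (d : ℚ)) {P : W.toAffine.Point} {c₀ : ℕ} {ℓ : ℤ} (hc₀ : c₀ ≠ 0)
    (hker : (W.baseChange ℚ_[2]).IsInReductionKernel (c₀ • W.toPadicPoint 2 P))
    (hℓ : ‖(W.baseChange ℚ_[2]).padicLogPoint (c₀ • W.toPadicPoint 2 P) / (c₀ : ℚ_[2])‖ = (2 : ℝ) ^ (-ℓ)) (N : ℕ) :
    (∃ y T : (W.baseChange ℚ_[2]).toAffine.Point, IsOfFinAddOrder T ∧ 2 ^ N • y + T = W.toPadicPoint 2 P) ↔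
      N ≤ ℓ.toNat - (if d % 8 = 3 then 1 else 0) := by
  rw [exists_pow_smul_add_torsion_iff_of_frame hsq hd4 W hC hc₀ hker hℓ N]
  have hel : (if d % 8 = 3 then (1 : ℤ) else 0) ≤ ℓ := le_ell_of_smul_eq_quadraticTwist d hd hsq hd4 W C hC P c₀ ℓ hc₀ hker hℓ
  split_ifs at hel ⊢ with h3 <;> omega

end Summit.BirchSwinnertonDyer.BirchSwinnertonDyer.Theorems.PrintCf2.DyadicTorsion

end
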